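import Summits.KontsevichZagierPeriods.KontsevichZagierPeriods.Theorems.HermiteRigidityReductionRigidityDupJoinKernelGen
import Summits.KontsevichZagierPeriods.KontsevichZagierPeriods.Theorems.HermiteRigidityReductionRigidityDupMoveRat
import Literature.NumberTheory.DiophantineApproximation.PolylogTwoPointsLinearIndependenceRational

/-!
# `ReductionRigidity` (stmt-KontsevichZagierPeriods-3407), line `Sketch`: THE DUPLICATION JOIN ISLAND AT RATIONAL LEVELS
# (`stub_dupJoinKernelRat`), UNCONDITIONAL at `q = N/M` for `log N ≥ 4(w+1)³ + 4w log M` (`stub_dupJoinKernelRatUnconditional`)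

Route `KontsevichZagierPeriods/HermiteRigidity`, crux `ReductionRigidity` (stmt-3407, summit-equivalent; skeleton
`Cruxes/ReductionRigidity/Lines/Sketch.lean` v7). Lead seat c7, cycle 3 (growth item G12). The all-weight duplication join of
cycle 2 (`stub_dupJoinKernelGen`, integer level `N`) moved to a RATIONAL level `q > 1`: on the sector generated by all box
generators `[□ʲ, x^a/(ν − ∏x)^m]` (`j ≤ w`) at the three levels `ν = q`, `ν = −q`, `ν = q²`, Conjecture 1 of Kontsevich–Zagier
holds in kernel form as soon as `1, Li_s(1/q), Li_s(−1/q)` (`s ≤ w`) are ℚ-linearly independent (`stub_dupJoinKernelRat`, rigidity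
inlined; moves = the rational-level duplication chains `stub_dupMoveRat`), and that rigidity is a THEOREM of the tree at `q = N/M`
for `log N ≥ 4(w+1)³ + 4w log M` (`Literature.NumberTheory.DiophantineApproximation.one_polylog_twoPoints_linearIndependent_rat`,
the rational-point extension of the parity Hermite–Padé programme), whence `stub_dupJoinKernelRatUnconditional`.

References: M. Kontsevich, D. Zagier, *Periods* (2001), §1.2 [cite: KontsevichZagier2001, §1.2]; S. David, N. Hirata-Kohno,
M. Kawashima, Moscow J. Comb. Number Theory 9 (2020), Thm 2.1 [cite: DavidHirataKohnoKawashima2020, Thm 2.1]. No definitions are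
introduced.
-/

noncomputable section

open MeasureTheory Set MvPolynomial

namespace Summit.KontsevichZagierPeriods.HermiteRigidity.ReductionRigidity

open Literature.NumberTheory.Transcendental
open Literature.NumberTheory.Transcendental.KZ

/-- **Stub `stub_dupJoinKernelRat`** (sub-goal of crux `ReductionRigidity`, stmt-3407, line `Sketch`, lead c7 cycle 3): **the
duplication join island in every weight at a RATIONAL level `q > 1`, rigidity inlined.** IF the `2w + 1` numbers
`1, ∫_□ⁱ dp/(q − ∏p), ∫_□ⁱ dp/((−q) − ∏p)` (`1 ≤ i ≤ w`; `= 1, Li_i(1/q), Li_i(−1/q)`) are ℚ-linearly independent, THEN Conjecture 1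
of Kontsevich–Zagier holds in kernel form on the sector generated by ALL box generators `[□ʲ, x^a/(ν − ∏x)^m]`, `j ≤ w`, at the THREE
levels `ν = q`, `ν = −q`, `ν = q²`: every `ℤ`-combination of value `0` is a chain of moves. Same mechanism as `stub_dupJoinKernelGen`
(`levelNormalForm` ×3, the level `q²` eliminated by the duplication move chains `stub_dupMoveRat`, `two_carriers_neg` /
`three_carriers_zero`). [cite: KontsevichZagier2001, §1.2] [cite: DavidHirataKohnoKawashima2020, Thm 2.1] -/
theorem stub_dupJoinKernelRat : ∀ (w : ℕ) (q : ℚ), 1 < q →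
    (∀ (a : ℚ) (b c : ℕ → ℚ),
      (a : ℝ) + ∑ i ∈ Finset.range w, (b i : ℝ) * (∫ p in cube (i + 1), 1 / ((q : ℝ) - ∏ l, p l)) +
          ∑ i ∈ Finset.range w, (c i : ℝ) * (∫ p in cube (i + 1), 1 / ((-(q : ℝ)) - ∏ l, p l)) = 0 →
        a = 0 ∧ (∀ i ∈ Finset.range w, b i = 0) ∧ (∀ i ∈ Finset.range w, c i = 0)) →
    ∀ c ∈ AddSubgroup.closure
      ({c | ∃ (j : ℕ) (r : IntegralRep j) (a : Fin j → ℕ) (m : ℕ), j ≤ w ∧ r.domain = cube j ∧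
          EqOn r.integrand (fun p => (∏ l, p l ^ a l) / ((q : ℝ) - ∏ l, p l) ^ m) (cube j) ∧ c = KZ.of r} ∪
        {c | ∃ (j : ℕ) (r : IntegralRep j) (a : Fin j → ℕ) (m : ℕ), j ≤ w ∧ r.domain = cube j ∧
          EqOn r.integrand (fun p => (∏ l, p l ^ a l) / ((-(q : ℝ)) - ∏ l, p l) ^ m) (cube j) ∧ c = KZ.of r} ∪
        {c | ∃ (j : ℕ) (r : IntegralRep j) (a : Fin j → ℕ) (m : ℕ), j ≤ w ∧ r.domain = cube j ∧
          EqOn r.integrand (fun p => (∏ l, p l ^ a l) / ((q : ℝ) ^ 2 - ∏ l, p l) ^ m) (cube j) ∧ c = KZ.of r}),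
      KZ.eval c = 0 → c ∈ KZ.relations := by
  intro w q hq hrig c hc h0
  have hν₁ : (1 : ℚ) < q ∨ q < 0 := Or.inl hq
  have hν₂ : (1 : ℚ) < (-q) ∨ (-q) < 0 := Or.inr (by linarith)
  have hν₃ : (1 : ℚ) < (q ^ 2) ∨ (q ^ 2) < 0 := Or.inl (by nlinarith)
  have hqR : (1 : ℝ) < (q : ℝ) := by exact_mod_cast hq
  have c₂R : (((-q) : ℚ) : ℝ) = -(q : ℝ) := by push_cast; ring
  have c₃R : (((q ^ 2 : ℚ)) : ℝ) = (q : ℝ) ^ 2 := by push_cast; ring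
  -- split `c` along the three levels and take normal forms
  rw [AddSubgroup.closure_union, AddSubgroup.closure_union] at hc
  obtain ⟨xy, hxy, z, hz, rfl⟩ := AddSubgroup.mem_sup.1 hc
  obtain ⟨x, hx, y, hy, rfl⟩ := AddSubgroup.mem_sup.1 hxy
  obtain ⟨α, s, hs, hxs⟩ := levelNormalForm hν₁ w x (by
    refine AddSubgroup.closure_mono (fun c hc => ?_) hx
    obtain ⟨j, r, a, m, hj, hr, hri, rfl⟩ := hc
    exact ⟨j, r, a, m, hj, hr, fun p hp => by rw [hri hp], rfl⟩)
  obtain ⟨β, t, ht, hyt⟩ := levelNormalForm hν₂ w y (by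
    refine AddSubgroup.closure_mono (fun c hc => ?_) hy
    obtain ⟨j, r, a, m, hj, hr, hri, rfl⟩ := hc
    exact ⟨j, r, a, m, hj, hr, fun p hp => by rw [hri hp, c₂R], rfl⟩)
  obtain ⟨γ, u, hu, hzu⟩ := levelNormalForm hν₃ w z (by
    refine AddSubgroup.closure_mono (fun c hc => ?_) hz
    obtain ⟨j, r, a, m, hj, hr, hri, rfl⟩ := hc
    exact ⟨j, r, a, m, hj, hr, fun p hp => by rw [hri hp, c₃R], rfl⟩)
  -- the duplication move chains in weights `i + 1`, `i < w`, scaled by `γ (i+1)`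
  choose sP hsP hsPi using fun i : ℕ => exists_nfRep (i := i + 1) hν₁ (2 ^ i * γ (i + 1))
  choose tP htP htPi using fun i : ℕ => exists_nfRep (i := i + 1) hν₂ (2 ^ i * γ (i + 1))
  have hmove : ∀ i, KZ.of (u (i + 1)) - KZ.of (sP i) - KZ.of (tP i) ∈ KZ.relations := by
    intro i
    refine stub_dupMoveRat q hq (i + 1) (Nat.succ_pos i) (γ (i + 1)) (u (i + 1)) (sP i) (tP i) (hu (i + 1)).1
      (fun p hp => by rw [(hu (i + 1)).2 hp, c₃R]) (hsP i) (fun p hp => ?_) (htP i) (fun p hp => ?_)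
    · rw [hsPi i hp, Nat.add_sub_cancel]
    · rw [htPi i hp, Nat.add_sub_cancel, c₂R]
  -- VALUES
  set I : ℕ → ℝ → ℝ := fun i ν => ∫ p in cube i, 1 / (ν - ∏ l, p l) with hI
  have I0 : ∀ ν : ℚ, (∫ p in cube 0, 1 / ((ν : ℝ) - ∏ l, p l)) = 1 / ((ν : ℝ) - 1) := integral_cube_zero_level
  have evx : KZ.eval x = ∑ i ∈ Finset.range (w + 1), (α i : ℝ) * I i q := by
    have e := eval_eq_zero_of_mem_relations hxs
    rw [map_sub, map_sum, sub_eq_zero] at e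
    rw [e]
    refine Finset.sum_congr rfl fun i _ => ?_
    rw [eval_nfRep (hs i).1 (hs i).2]
  have evy : KZ.eval y = ∑ i ∈ Finset.range (w + 1), (β i : ℝ) * I i (-(q : ℝ)) := by
    have e := eval_eq_zero_of_mem_relations hyt
    rw [map_sub, map_sum, sub_eq_zero] at e
    rw [e]
    refine Finset.sum_congr rfl fun i _ => ?_
    rw [eval_nfRep (ht i).1 (ht i).2, c₂R]
  have evz : KZ.eval z = ∑ i ∈ Finset.range (w + 1), (γ i : ℝ) * I i ((q : ℝ) ^ 2) := by
    have e := eval_eq_zero_of_mem_relations hzu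
    rw [map_sub, map_sum, sub_eq_zero] at e
    rw [e]
    refine Finset.sum_congr rfl fun i _ => ?_
    rw [eval_nfRep (hu i).1 (hu i).2, c₃R]
  -- split off the constants `i = 0`
  have evx' : KZ.eval x = (α 0 : ℝ) * (1 / ((q : ℝ) - 1)) + ∑ i ∈ Finset.range w, (α (i + 1) : ℝ) * I (i + 1) q := by
    rw [evx, Finset.sum_range_succ', add_comm]
    congr 1
    simp only [hI]
    rw [I0]
  have evy' : KZ.eval y = (β 0 : ℝ) * (1 / (-(q : ℝ) - 1)) +
      ∑ i ∈ Finset.range w, (β (i + 1) : ℝ) * I (i + 1) (-(q : ℝ)) := by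
    rw [evy, Finset.sum_range_succ', add_comm]
    congr 1
    simp only [hI]
    rw [← c₂R, I0]
  have evz' : KZ.eval z = (γ 0 : ℝ) * (1 / ((q : ℝ) ^ 2 - 1)) +
      ∑ i ∈ Finset.range w, (γ (i + 1) : ℝ) * I (i + 1) ((q : ℝ) ^ 2) := by
    rw [evz, Finset.sum_range_succ', add_comm]
    congr 1
    simp only [hI]
    rw [← c₃R, I0]
  -- the duplication VALUE relations (soundness of the move chains), summed
  have hdup : ∀ i, (γ (i + 1) : ℝ) * I (i + 1) ((q : ℝ) ^ 2) -
      ((2 ^ i * γ (i + 1) : ℚ) : ℝ) * I (i + 1) q - ((2 ^ i * γ (i + 1) : ℚ) : ℝ) * I (i + 1) (-(q : ℝ)) = 0 := by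
    intro i
    have e := eval_eq_zero_of_mem_relations (hmove i)
    rw [map_sub, map_sub, eval_nfRep (hu (i + 1)).1 (hu (i + 1)).2, eval_nfRep (hsP i) (hsPi i),
      eval_nfRep (htP i) (htPi i), c₂R, c₃R] at e
    simpa only [hI] using e
  have hdupSum : ∑ i ∈ Finset.range w, (γ (i + 1) : ℝ) * I (i + 1) ((q : ℝ) ^ 2) =
      ∑ i ∈ Finset.range w, ((2 ^ i * γ (i + 1) : ℚ) : ℝ) * I (i + 1) q +
        ∑ i ∈ Finset.range w, ((2 ^ i * γ (i + 1) : ℚ) : ℝ) * I (i + 1) (-(q : ℝ)) := by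
    rw [← Finset.sum_add_distrib]
    exact Finset.sum_congr rfl fun i _ => by linear_combination hdup i
  -- the value of `c`, in the shape of the rigidity hypothesis
  have h0' : KZ.eval x + KZ.eval y + KZ.eval z = 0 := by rwa [map_add, map_add] at h0
  have hB : ∑ i ∈ Finset.range w, ((α (i + 1) + 2 ^ i * γ (i + 1) : ℚ) : ℝ) * I (i + 1) q =
      ∑ i ∈ Finset.range w, (α (i + 1) : ℝ) * I (i + 1) q +
        ∑ i ∈ Finset.range w, ((2 ^ i * γ (i + 1) : ℚ) : ℝ) * I (i + 1) q := by
    rw [← Finset.sum_add_distrib]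
    exact Finset.sum_congr rfl fun i _ => by push_cast; ring
  have hC : ∑ i ∈ Finset.range w, ((β (i + 1) + 2 ^ i * γ (i + 1) : ℚ) : ℝ) * I (i + 1) (-(q : ℝ)) =
      ∑ i ∈ Finset.range w, (β (i + 1) : ℝ) * I (i + 1) (-(q : ℝ)) +
        ∑ i ∈ Finset.range w, ((2 ^ i * γ (i + 1) : ℚ) : ℝ) * I (i + 1) (-(q : ℝ)) := by
    rw [← Finset.sum_add_distrib]
    exact Finset.sum_congr rfl fun i _ => by push_cast; ring
  have hval : ((α 0 / (q - 1) + β 0 / (-q - 1) + γ 0 / (q ^ 2 - 1) : ℚ) : ℝ) +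
      ∑ i ∈ Finset.range w, ((α (i + 1) + 2 ^ i * γ (i + 1) : ℚ) : ℝ) *
        (∫ p in cube (i + 1), 1 / ((q : ℝ) - ∏ l, p l)) +
      ∑ i ∈ Finset.range w, ((β (i + 1) + 2 ^ i * γ (i + 1) : ℚ) : ℝ) *
        (∫ p in cube (i + 1), 1 / ((-(q : ℝ)) - ∏ l, p l)) = 0 := by
    have eB : ∑ i ∈ Finset.range w, ((α (i + 1) + 2 ^ i * γ (i + 1) : ℚ) : ℝ) *
        (∫ p in cube (i + 1), 1 / ((q : ℝ) - ∏ l, p l)) =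
        ∑ i ∈ Finset.range w, ((α (i + 1) + 2 ^ i * γ (i + 1) : ℚ) : ℝ) * I (i + 1) q := by
      simp only [hI]
    have eC : ∑ i ∈ Finset.range w, ((β (i + 1) + 2 ^ i * γ (i + 1) : ℚ) : ℝ) *
        (∫ p in cube (i + 1), 1 / ((-(q : ℝ)) - ∏ l, p l)) =
        ∑ i ∈ Finset.range w, ((β (i + 1) + 2 ^ i * γ (i + 1) : ℚ) : ℝ) * I (i + 1) (-(q : ℝ)) := by
      simp only [hI]
    rw [eB, eC, hB, hC]
    have hN1 : (q : ℝ) - 1 ≠ 0 := by linarith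
    have hN2 : -(q : ℝ) - 1 ≠ 0 := by linarith
    have hN3 : (q : ℝ) ^ 2 - 1 ≠ 0 := by nlinarith
    push_cast at hdupSum ⊢
    linear_combination h0' - evx' - evy' - evz' - hdupSum
  obtain ⟨hA, hBi, hCi⟩ := hrig _ (fun i => α (i + 1) + 2 ^ i * γ (i + 1)) (fun i => β (i + 1) + 2 ^ i * γ (i + 1)) hval
  -- RELATIONS: weight `i + 1` — the move chain kills `u (i+1) + s (i+1) + t (i+1)`
  have hS : ∀ i ∈ Finset.range w, KZ.of (s (i + 1)) + KZ.of (t (i + 1)) + KZ.of (u (i + 1)) ∈ KZ.relations := by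
    intro i hi
    have hαi : α (i + 1) = -(2 ^ i * γ (i + 1)) := by linarith [hBi i hi]
    have hβi : β (i + 1) = -(2 ^ i * γ (i + 1)) := by linarith [hCi i hi]
    have hb : KZ.of (sP i) + KZ.of (s (i + 1)) ∈ KZ.relations :=
      two_carriers_neg (D := cube (i + 1)) (fun b p => (b : ℝ) / ((q : ℝ) - ∏ l, p l)) (fun b b' p => by push_cast; ring)
        (fun p => by simp) (fun b => by
          obtain ⟨r, hr, hri⟩ := exists_nfRep (i := i + 1) hν₁ b
          exact ⟨r, hr, fun p hp => by rw [hri hp]⟩) (β := 2 ^ i * γ (i + 1))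
        (hsP i) (fun p hp => by rw [hsPi i hp]) (hs (i + 1)).1
        (fun p hp => by rw [(hs (i + 1)).2 hp, hαi])
    have hc' : KZ.of (tP i) + KZ.of (t (i + 1)) ∈ KZ.relations :=
      two_carriers_neg (D := cube (i + 1)) (fun b p => (b : ℝ) / ((-(q : ℝ)) - ∏ l, p l)) (fun b b' p => by push_cast; ring)
        (fun p => by simp) (fun b => by
          obtain ⟨r, hr, hri⟩ := exists_nfRep (i := i + 1) hν₂ b
          exact ⟨r, hr, fun p hp => by rw [hri hp, c₂R]⟩) (β := 2 ^ i * γ (i + 1))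
        (htP i) (fun p hp => by rw [htPi i hp, c₂R]) (ht (i + 1)).1
        (fun p hp => by rw [(ht (i + 1)).2 hp, hβi, c₂R])
    have : KZ.of (s (i + 1)) + KZ.of (t (i + 1)) + KZ.of (u (i + 1)) =
        (KZ.of (u (i + 1)) - KZ.of (sP i) - KZ.of (tP i)) + (KZ.of (sP i) + KZ.of (s (i + 1))) +
          (KZ.of (tP i) + KZ.of (t (i + 1))) := by abel
    rw [this]
    exact KZ.relations.add_mem (KZ.relations.add_mem (hmove i) hb) hc'
  -- weight zero: three constants summing to `0`
  have hZ : KZ.of (s 0) + KZ.of (t 0) + KZ.of (u 0) ∈ KZ.relations := by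
    refine three_carriers_zero (D := cube 0) (fun b _ => (b : ℝ)) (fun b b' p => by push_cast; ring)
      (fun p => by simp) (fun b => exists_nf0 b) (β₁ := α 0 / (q - 1)) (β₂ := β 0 / (-q - 1))
      (β₃ := γ 0 / (q ^ 2 - 1)) hA (hs 0).1 (fun p hp => ?_) (ht 0).1 (fun p hp => ?_) (hu 0).1 (fun p hp => ?_)
    · rw [(hs 0).2 hp]; simp [Finset.univ_eq_empty]
    · rw [(ht 0).2 hp]; simp [Finset.univ_eq_empty]
    · rw [(hu 0).2 hp]; simp [Finset.univ_eq_empty]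
  -- all weights together
  have hAll : ∑ i ∈ Finset.range (w + 1), (KZ.of (s i) + KZ.of (t i) + KZ.of (u i)) ∈ KZ.relations := by
    rw [Finset.sum_range_succ']
    exact KZ.relations.add_mem (KZ.relations.sum_mem fun i hi => hS i hi) hZ
  have : x + y + z = (x - ∑ i ∈ Finset.range (w + 1), KZ.of (s i)) + (y - ∑ i ∈ Finset.range (w + 1), KZ.of (t i)) +
      (z - ∑ i ∈ Finset.range (w + 1), KZ.of (u i)) +
      ∑ i ∈ Finset.range (w + 1), (KZ.of (s i) + KZ.of (t i) + KZ.of (u i)) := by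
    rw [Finset.sum_add_distrib, Finset.sum_add_distrib]
    abel
  rw [this]
  exact KZ.relations.add_mem (KZ.relations.add_mem (KZ.relations.add_mem hxs hyt) hzu) hAll


/-- **Stub `stub_dupJoinKernelRatUnconditional`**: **THE DUPLICATION JOIN ISLAND AT THE RATIONAL LEVELS `N/M`, `−N/M`, `(N/M)²`,
UNCONDITIONAL** for `w ≥ 1`, `M ≥ 1` and `log N ≥ 4(w+1)³ + 4w log M`: Conjecture 1 of Kontsevich–Zagier in kernel form on the
three-level box sector in all dimensions `≤ w`, with NO hypothesis — `stub_dupJoinKernelRat` at `q = N/M` fed with the PROVED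
rigidity `one_polylog_twoPoints_linearIndependent_rat` (`1, Li_s(M/N), Li_s(−M/N)`, `s ≤ w`, ℚ-independent), the cube values being
`Li_i(±M/N)` by `integral_cube_one_div_prod_absLevel`. [cite: KontsevichZagier2001, §1.2] [cite: DavidHirataKohnoKawashima2020, Thm 2.1] -/
theorem stub_dupJoinKernelRatUnconditional : ∀ (w M N : ℕ), 1 ≤ w → 1 ≤ M →
    4 * ((w : ℝ) + 1) ^ 3 + 4 * w * Real.log M ≤ Real.log N →
    ∀ c ∈ AddSubgroup.closure
      ({c | ∃ (j : ℕ) (r : IntegralRep j) (a : Fin j → ℕ) (m : ℕ), j ≤ w ∧ r.domain = cube j ∧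
          EqOn r.integrand (fun p => (∏ l, p l ^ a l) / ((N : ℝ) / M - ∏ l, p l) ^ m) (cube j) ∧ c = KZ.of r} ∪
        {c | ∃ (j : ℕ) (r : IntegralRep j) (a : Fin j → ℕ) (m : ℕ), j ≤ w ∧ r.domain = cube j ∧
          EqOn r.integrand (fun p => (∏ l, p l ^ a l) / ((-((N : ℝ) / M)) - ∏ l, p l) ^ m) (cube j) ∧ c = KZ.of r} ∪
        {c | ∃ (j : ℕ) (r : IntegralRep j) (a : Fin j → ℕ) (m : ℕ), j ≤ w ∧ r.domain = cube j ∧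
          EqOn r.integrand (fun p => (∏ l, p l ^ a l) / (((N : ℝ) / M) ^ 2 - ∏ l, p l) ^ m) (cube j) ∧ c = KZ.of r}),
      KZ.eval c = 0 → c ∈ KZ.relations := by
  intro w M N hw hM hlog
  -- `N ≥ 2M`, so `q = N/M > 1`
  have hw1 : (1 : ℝ) ≤ w := by exact_mod_cast hw
  have hM1 : (1 : ℝ) ≤ M := by exact_mod_cast hM
  have hMpos : (0 : ℝ) < M := by positivity
  have hlogM : 0 ≤ Real.log M := Real.log_nonneg hM1
  have hL : (32 : ℝ) + Real.log M ≤ Real.log N := by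
    have h3 : (32 : ℝ) ≤ 4 * ((w : ℝ) + 1) ^ 3 := by
      calc (32 : ℝ) = 4 * 2 ^ 3 := by norm_num
        _ ≤ 4 * ((w : ℝ) + 1) ^ 3 := by gcongr; linarith
    have h4 : Real.log M ≤ 4 * w * Real.log M := by nlinarith
    linarith
  have hN0 : (N : ℝ) ≠ 0 := by
    intro h0; rw [h0, Real.log_zero] at hL; linarith
  have hNpos : (0 : ℝ) < N := lt_of_le_of_ne (Nat.cast_nonneg N) (Ne.symm hN0)
  have h2MR : (2 : ℝ) * M ≤ N := by
    have hlog2 : Real.log 2 ≤ 2 - 1 := Real.log_le_sub_one_of_pos two_pos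
    have h2M : Real.log (2 * M) ≤ Real.log N := by
      rw [Real.log_mul two_ne_zero hMpos.ne']
      linarith
    exact (Real.log_le_log_iff (by positivity) hNpos).1 h2M
  set q : ℚ := (N : ℚ) / M with hqdef
  have hqR : (q : ℝ) = (N : ℝ) / M := by rw [hqdef]; push_cast; ring
  have hq : 1 < q := by
    have : (1 : ℝ) < (q : ℝ) := by
      rw [hqR, lt_div_iff₀ hMpos]; linarith
    exact_mod_cast this
  have hq1R : 1 < |(q : ℝ)| := by
    rw [abs_of_pos (by rw [hqR]; positivity)]; exact_mod_cast hq
  -- the island at level `q`, rewritten at `N/M`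
  have key := stub_dupJoinKernelRat w q hq
  simp only [hqR] at key
  refine key fun a b c h => ?_
  -- the cube values as polylogarithm series at `±M/N`
  have IP : ∀ i, (∫ p in cube (i + 1), 1 / ((N : ℝ) / M - ∏ l, p l)) =
      Literature.NumberTheory.DiophantineApproximation.DilogPade.polylogSeries (i + 1) ((M : ℝ) / N) := fun i => by
    rw [← hqR, integral_cube_one_div_prod_absLevel (i + 1) (q : ℝ) hq1R,
      Literature.NumberTheory.DiophantineApproximation.DilogPade.polylogSeries, hqR, one_div_div]
  have IM : ∀ i, (∫ p in cube (i + 1), 1 / ((-((N : ℝ) / M)) - ∏ l, p l)) =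
      Literature.NumberTheory.DiophantineApproximation.DilogPade.polylogSeries (i + 1) (-((M : ℝ) / N)) := fun i => by
    have hq1R' : 1 < |(-((N : ℝ) / M))| := by rw [abs_neg, ← hqR]; exact hq1R
    rw [integral_cube_one_div_prod_absLevel (i + 1) (-((N : ℝ) / M)) hq1R',
      Literature.NumberTheory.DiophantineApproximation.DilogPade.polylogSeries]
    refine tsum_congr fun k => ?_
    rw [one_div_neg_eq_neg_one_div, one_div_div]
  simp_rw [IP, IM] at h
  have key2 := Literature.NumberTheory.DiophantineApproximation.one_polylog_twoPoints_linearIndependent_rat w hw M N hM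
    hlog a (fun j : Fin w => b j) (fun j : Fin w => c j) (by
      rw [Finset.sum_range (fun i => (b i : ℝ) *
          Literature.NumberTheory.DiophantineApproximation.DilogPade.polylogSeries (i + 1) ((M : ℝ) / N)),
        Finset.sum_range (fun i => (c i : ℝ) *
          Literature.NumberTheory.DiophantineApproximation.DilogPade.polylogSeries (i + 1) (-((M : ℝ) / N)))] at h
      exact h)
  obtain ⟨ha, hb, hc⟩ := key2
  refine ⟨ha, fun i hi => ?_, fun i hi => ?_⟩
  · have := congrFun hb ⟨i, Finset.mem_range.1 hi⟩
    simpa using this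
  · have := congrFun hc ⟨i, Finset.mem_range.1 hi⟩
    simpa using this

end Summit.KontsevichZagierPeriods.HermiteRigidity.ReductionRigidity

end
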